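import Summits.ValiantsHypothesis.ValiantsHypothesis.Theses.BarrierLever

/-!
# Route BarrierLever — support item `LeverThesisOfCruxes`

Glue: the two cruxes `SuccinctHittingSetsForVP` and `DefinableEquations` together give the
target `LeverThesis`, which is literally their conjunction (the route-side crux
`SuccinctHittingSetsForVP` unfolds to `Literature.Barriers.ValiantsHypothesis.SuccinctHittingSetsForVP ℂ`,
the first conjunct of `LeverThesis`; `DefinableEquations` is its second conjunct verbatim).
-/

-- `Summit.ValiantsHypothesis.ValiantsHypothesis.…` is the tree's mandated single-conjunct layout
-- (Sub = Summit), so the duplicated namespace component is intended.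
set_option linter.dupNamespace false

namespace Summit.ValiantsHypothesis.ValiantsHypothesis.Theorems

open Summit.ValiantsHypothesis.ValiantsHypothesis.Theses.BarrierLever

/-- Item stmt-ValiantsHypothesis-14192 (support `LeverThesisOfCruxes` of route BarrierLever):
`SuccinctHittingSetsForVP → DefinableEquations → LeverThesis`, by pairing the two hypotheses. -/
theorem leverThesisOfCruxes_proof :
    Summit.ValiantsHypothesis.ValiantsHypothesis.Theses.BarrierLever.LeverThesisOfCruxes := by
  unfold LeverThesisOfCruxes
  intro h₁ h₂
  exact ⟨h₁, h₂⟩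

end Summit.ValiantsHypothesis.ValiantsHypothesis.Theorems
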